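import Mathlib.Algebra.Order.BigOperators.Group.Finset
import Mathlib.Data.Nat.Choose.Basic
import Mathlib.Data.Fintype.Perm
import Mathlib.Logic.Equiv.Fintype
import Literature.Computability.AlgebraicComplexity.LRTorusWeights
import HarnessLib

/-!
# Crux `ProjectionStability.OptStep` (stmt-ValiantsHypothesis-17835), line `Sketch` —
# registered stub `stub_coverCount` (H2, the covering count)

**Double counting over `𝔖_m`.** To every permutation `π` of `Fin m` attach an exponent vector
`lab π : Fin m → ℕ` with exactly `s` non-zero entries (`|supp (lab π)| = s`, `LRPencil.supp`).
Then the pairs `(lab π, lab π ∘ π⁻¹)` ("row multiplicities, column multiplicities") take at least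
`C(m, s)` distinct values.  In the proof of the two-sided-torus lower bound K2 of the line, distinct
pairs are distinct torus weights, hence linearly independent weight vectors.

Proof.  Let `f π := (lab π, lab π ∘ π⁻¹)`.  If `f π = f π₀` then `a := lab π = lab π₀` and
`a ∘ π⁻¹ = a ∘ π₀⁻¹`, so `ρ := π₀⁻¹ π` satisfies `a ∘ ρ = a`; such a `ρ` maps `S := supp a` onto
itself, hence lies in the image of the block embedding `Perm S × Perm Sᶜ → Perm (Fin m)`
(`Equiv.Perm.subtypeCongr`), a set of `s! (m − s)!` elements.  So every fibre of `f` on `𝔖_m` has at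
most `s! (m − s)!` elements (`card_filter_comp_perm_eq_le`, `card_fibre_le`), and
`m! ≤ s! (m − s)! · #image` (`Finset.card_le_mul_card_image`); with
`C(m, s) · s! · (m − s)! = m!` (`Nat.choose_mul_factorial_mul_factorial`) this is `C(m, s) ≤ #image`
(for `s > m`, `C(m, s) = 0`).

* `mem_supp_iff` — membership in `LRPencil.supp`.
* `card_filter_comp_perm_eq_le` — `#{ρ ∈ 𝔖_m | a ∘ ρ = a} ≤ |supp a|! (m − |supp a|)!`
  (block embedding; the set-wise-stabiliser computation of
  `Summit.MatrixMultiplication.…GlobalBranch.mem_range_subtypeCongrHom_of_map_eq`, redone here to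
  keep the import light).
* `card_fibre_le` — every fibre of `f` has at most `s! (m − s)!` elements.
* `stub_coverCount` — the registered signature.

Unconditional (no named facts); Mathlib: `Finset.card_le_mul_card_image`,
`Nat.choose_mul_factorial_mul_factorial`, `Fintype.card_perm`, `Equiv.Perm.subtypeCongr`,
`Equiv.Perm.subtypePerm`; tree: `Literature.Computability.AlgebraicComplexity.LRPencil.supp`.
-/

-- layout Summits/ValiantsHypothesis/ValiantsHypothesis forces the duplicated namespace component
set_option linter.dupNamespace false

namespace Summit.ValiantsHypothesis.ValiantsHypothesis.Theorems.ProjectionStabilityOptStep.CoverCount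

open Literature.Computability.AlgebraicComplexity

/-- Membership in the support `LRPencil.supp u = {i | u i ≠ 0}` of an exponent vector. [folklore] -/
theorem mem_supp_iff {m : ℕ} (u : Fin m → ℕ) (i : Fin m) : i ∈ LRPencil.supp u ↔ u i ≠ 0 := by
  simp [LRPencil.supp]

/-- **Stabiliser bound.** The permutations `ρ` of `Fin m` with `a ∘ ρ = a` preserve the support
`S := supp a` set-wise, so they lie in the image of the block embedding
`Perm S × Perm Sᶜ → Perm (Fin m)` (`Equiv.Perm.subtypeCongr`); hence there are at most
`|S|! · (m − |S|)!` of them. [folklore] -/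
theorem card_filter_comp_perm_eq_le {m : ℕ} (a : Fin m → ℕ) :
    (Finset.univ.filter fun ρ : Equiv.Perm (Fin m) => a ∘ ⇑ρ = a).card ≤
      (LRPencil.supp a).card.factorial * (m - (LRPencil.supp a).card).factorial := by
  classical
  set S : Finset (Fin m) := LRPencil.supp a with hS
  let g : Equiv.Perm {x // x ∈ S} × Equiv.Perm {x // ¬ x ∈ S} → Equiv.Perm (Fin m) :=
    fun pq => Equiv.Perm.subtypeCongr pq.1 pq.2
  have hsub : (Finset.univ.filter fun ρ : Equiv.Perm (Fin m) => a ∘ ⇑ρ = a) ⊆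
      Finset.univ.image g := by
    intro ρ hρ
    have hρa : a ∘ ⇑ρ = a := (Finset.mem_filter.1 hρ).2
    have hiff : ∀ x, ρ x ∈ S ↔ x ∈ S := fun x => by
      rw [hS, mem_supp_iff, mem_supp_iff, show a (ρ x) = a x from congrFun hρa x]
    have hiff' : ∀ x, ¬ (ρ x ∈ S) ↔ ¬ (x ∈ S) := fun x => not_congr (hiff x)
    refine Finset.mem_image.2 ⟨(ρ.subtypePerm hiff, ρ.subtypePerm hiff'), Finset.mem_univ _, ?_⟩
    ext x
    by_cases hx : x ∈ S
    · simp [g, Equiv.Perm.subtypeCongr.left_apply _ _ hx]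
    · simp [g, Equiv.Perm.subtypeCongr.right_apply _ _ hx]
  calc (Finset.univ.filter fun ρ : Equiv.Perm (Fin m) => a ∘ ⇑ρ = a).card
      ≤ (Finset.univ.image g).card := Finset.card_le_card hsub
    _ ≤ (Finset.univ : Finset (Equiv.Perm {x // x ∈ S} × Equiv.Perm {x // ¬ x ∈ S})).card :=
        Finset.card_image_le
    _ = S.card.factorial * (m - S.card).factorial := by
        rw [Finset.card_univ, Fintype.card_prod, Fintype.card_perm, Fintype.card_perm,
          Fintype.card_coe, Fintype.card_subtype_compl, Fintype.card_fin, Fintype.card_coe]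

/-- **Fibre bound.** If every label `lab π` has exactly `s` non-zero entries, then every fibre of
`π ↦ (lab π, lab π ∘ π⁻¹)` on `𝔖_m` has at most `s! (m − s)!` elements: left translation by
`π₀⁻¹` injects the fibre through `π₀` into `{ρ | lab π₀ ∘ ρ = lab π₀}`
(`card_filter_comp_perm_eq_le`). [folklore] -/
theorem card_fibre_le {m s : ℕ} (lab : Equiv.Perm (Fin m) → (Fin m → ℕ))
    (hlab : ∀ π, (LRPencil.supp (lab π)).card = s) (π₀ : Equiv.Perm (Fin m)) :
    (Finset.univ.filter fun π : Equiv.Perm (Fin m) =>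
        (lab π, lab π ∘ ⇑π.symm) = (lab π₀, lab π₀ ∘ ⇑π₀.symm)).card ≤
      s.factorial * (m - s).factorial := by
  classical
  have key : (Finset.univ.filter fun π : Equiv.Perm (Fin m) =>
        (lab π, lab π ∘ ⇑π.symm) = (lab π₀, lab π₀ ∘ ⇑π₀.symm)).card ≤
      (Finset.univ.filter fun ρ : Equiv.Perm (Fin m) => lab π₀ ∘ ⇑ρ = lab π₀).card := by
    refine Finset.card_le_card_of_injOn (fun π => π₀⁻¹ * π) ?_ ?_
    · intro π hπ
      have hπ' := (Finset.mem_filter.1 (Finset.mem_coe.1 hπ)).2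
      obtain ⟨h1, h2⟩ := Prod.mk_inj.1 hπ'
      rw [h1] at h2
      refine Finset.mem_coe.2 (Finset.mem_filter.2 ⟨Finset.mem_univ _, ?_⟩)
      funext x
      have hx := congrFun h2 (π x)
      simp only [Function.comp_apply, Equiv.symm_apply_apply] at hx
      simp only [Function.comp_apply, Equiv.Perm.coe_mul, Equiv.Perm.inv_def]
      exact hx.symm
    · intro π _ π' _ h
      exact mul_left_cancel h
  refine key.trans ?_
  have := card_filter_comp_perm_eq_le (lab π₀)
  rwa [hlab π₀] at this

/-- **H2 — the covering count** (double counting over `𝔖_m`): if to every permutation `π` of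
`Fin m` is attached an exponent vector `lab π : Fin m → ℕ` with exactly `s` non-zero entries, then
the pairs `(lab π, lab π ∘ π⁻¹)` take at least `C(m, s)` distinct values: every fibre has at most
`s! (m − s)!` elements (`card_fibre_le`), so `m! ≤ s! (m − s)! · #image`
(`Finset.card_le_mul_card_image`, `Fintype.card_perm`), and `C(m, s) · s! · (m − s)! = m!`
(`Nat.choose_mul_factorial_mul_factorial`; `C(m, s) = 0` for `s > m`). [folklore] -/
theorem stub_coverCount :
    ∀ (m s : ℕ) (lab : Equiv.Perm (Fin m) → (Fin m → ℕ)),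
      (∀ π, (LRPencil.supp (lab π)).card = s) →
      m.choose s ≤ (Finset.univ.image fun π : Equiv.Perm (Fin m) => (lab π, lab π ∘ ⇑π.symm)).card := by
  classical
  intro m s lab hlab
  have hfib : ∀ b ∈ Finset.univ.image (fun π : Equiv.Perm (Fin m) => (lab π, lab π ∘ ⇑π.symm)),
      (Finset.univ.filter fun π : Equiv.Perm (Fin m) => (lab π, lab π ∘ ⇑π.symm) = b).card ≤
        s.factorial * (m - s).factorial := by
    intro b hb
    obtain ⟨π₀, -, rfl⟩ := Finset.mem_image.1 hb
    exact card_fibre_le lab hlab π₀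
  have hcount := Finset.card_le_mul_card_image (Finset.univ : Finset (Equiv.Perm (Fin m)))
    (s.factorial * (m - s).factorial) hfib
  rw [Finset.card_univ, Fintype.card_perm, Fintype.card_fin] at hcount
  by_cases hsm : s ≤ m
  · have hpos : 0 < s.factorial * (m - s).factorial :=
      Nat.mul_pos (Nat.factorial_pos _) (Nat.factorial_pos _)
    refine Nat.le_of_mul_le_mul_left ?_ hpos
    calc s.factorial * (m - s).factorial * m.choose s
        = m.choose s * s.factorial * (m - s).factorial := by ring
      _ = m.factorial := Nat.choose_mul_factorial_mul_factorial hsm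
      _ ≤ s.factorial * (m - s).factorial *
          (Finset.univ.image fun π : Equiv.Perm (Fin m) => (lab π, lab π ∘ ⇑π.symm)).card := hcount
  · rw [Nat.choose_eq_zero_of_lt (lt_of_not_ge hsm)]
    exact Nat.zero_le _

end Summit.ValiantsHypothesis.ValiantsHypothesis.Theorems.ProjectionStabilityOptStep.CoverCount
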